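import Literature.NumberTheory.Automorphic.CuspidalCohomologyGLRankOneCharacter
import Literature.NumberTheory.GaloisRepresentations.HeckeCharacterWeakApproximation
import Mathlib.Algebra.Module.CharacterModule
import Mathlib.LinearAlgebra.Matrix.GeneralLinearGroup.Defs
import HarnessLib

/-!
# Generators of `GL₁(𝔸_ℚ^∞)` modulo a level: `𝔸_{ℚ,f}^× = ℚ^×_{>0} · ⟨ϖ_p : p ∤ N⟩ · K_f(N)`

Topic `NumberTheory/Automorphic`; proof file (theorems only: no definition, no named fact, no
instance).  The finite idèles of `ℚ` are generated by the diagonally embedded positive rationals,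
the local uniformisers at the primes not dividing a level `N ≥ 1`, and the principal congruence
subgroup `K_f(N) = {u ∈ ẑ^× | u ≡ 1 (mod N)}`:

* `BigHeckeGLn.eq_top_of_level_le_of_globalEmbedding_mem_of_heckeElement_mem_rat` — **a subgroup of
  `GL₁(𝔸_ℚ^∞)` containing `K_f(N)`, the image of `GL₁(ℚ)⁺` and the Hecke elements `t_{v,1}`,
  `v ∤ N`, is everything.**  Classically this is `𝕀_ℚ = ℚ^× · (ℝ_{>0} × ẑ^×)` (class number one,
  [Neukirch, Ch. VI §1, Prop. (1.10)]; Gelbart (1975), (3.3)) together with the approximation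
  theorem `C_ℚ / C_ℚ^𝔪 ≅ (ℤ/m)^×`, i.e. every unit idèle is congruent modulo `𝔪` to a positive
  integer prime to `m` [Neukirch, Ch. VI §1, Prop. (1.9)]; it is the group-theoretic content of
  "a Hecke character of conductor dividing `N` and given infinity type is determined by its values
  at the `ϖ_p`, `p ∤ N`".  The proof given here is by duality: the preimage `S'` in `𝕀_ℚ` of the
  subgroup under `y ↦ (u(y))_f` (`u(y) = y · r(y)⁻¹` the unit part of
  `HeckeCharacterProofs`, `Rat.unitIdele`) is an open subgroup containing `ℚ^×`; if it were proper,
  a character of the abelian group `𝕀_ℚ / S'` non-trivial at a missing point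
  (`exists_monoidHom_unitsComplex_apply_ne_one`: `ℚ/ℤ`-valued characters separate points, Mathlib
  `CharacterModule.exists_character_apply_ne_zero_of_ne_zero`, and `ℚ/ℤ ↪ ℂ^×`) would be a Hecke
  character trivial on `ℚ_v^×` for every `v ∤ N`, contradicting the rigidity theorem
  `HeckeCharacter.eq_one_of_forall_localUnits` ("`K^× 𝕀^S` is dense", Cassels–Fröhlich, Ch. VII
  §4, Prop. 4.1, proved in `HeckeCharacterWeakApproximation`).
* On the way: the finite part `y ↦ y_f ∈ GL₁(𝔸_ℚ^∞)` of an idèle (`GLn.sndHom ∘ scalar`) on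
  `(1, g)`, on principal idèles and on local idèles (`sndHom_scalar_det_ofFinite`,
  `sndHom_scalar_principalIdele`, `sndHom_scalar_localUnits`), the Hecke element `t_{v,1}` and the
  local idèles of units as elements of `K_f(N)` (`glDiagonal_uniformizerIdele_mem_level_of_valued_eq_one`,
  `sndHom_scalar_mem_level_of_valued`).

This is the input of the rank-one case of the named fact
`GLnCohomology.interiorEigenclass_isCuspidal` (`CuspidalCohomologyGL`): a Hecke eigenclass in
`H⁰(ℚ^×_{>0} \ 𝔸_{ℚ,f}^× / K_f(N))` is an eigenfunction of ALL translations, hence a character.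

## References

* J. Neukirch, *Algebraic Number Theory* (1999), Ch. VI §1, Prop. (1.9), (1.10) [NeukirchANT1999].
* S. Gelbart, *Automorphic forms on adele groups*, Ann. of Math. Stud. 83 (1975), §2.A, (3.3)
  [Gelbart1975].
* J. W. S. Cassels, A. Fröhlich (eds.), *Algebraic Number Theory* (1967), Ch. VII (Tate), §4,
  Prop. 4.1 [CasselsFrohlichANT1967].
-/

noncomputable section

open scoped MatrixGroups Classical
open NumberField IsDedekindDomain Filter
open _root_.Topology

namespace Literature.NumberTheory.Automorphic

open Literature.NumberTheory.GaloisRepresentations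

/-! ### Characters with values in `ℂˣ` separate the points of an abelian group -/

section Characters

/-- **Characters into `ℂˣ` separate points**: for `q ≠ 1` in a commutative group `Q` there is a
homomorphism `φ : Q → ℂˣ` with `φ q ≠ 1` (`ℚ/ℤ`-valued characters separate points — Mathlib
`CharacterModule.exists_character_apply_ne_zero_of_ne_zero`, divisibility of `ℚ/ℤ` — and
`ℚ/ℤ ↪ ℂˣ` by `t ↦ e^{2πit}`). [folklore] -/
theorem exists_monoidHom_unitsComplex_apply_ne_one {Q : Type*} [CommGroup Q] {q : Q} (hq : q ≠ 1) :
    ∃ φ : Q →* ℂˣ, φ q ≠ 1 := by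
  have hq' : Additive.ofMul q ≠ 0 := by
    rwa [Ne, ← ofMul_one, Additive.ofMul.injective.eq_iff]
  obtain ⟨c, hc⟩ := CharacterModule.exists_character_apply_ne_zero_of_ne_zero hq'
  -- `r ↦ exp(2πir)` on `ℚ`
  let e : ℚ →+ Additive ℂˣ :=
    AddMonoidHom.mk'
      (fun r : ℚ => Additive.ofMul
        (Units.mk0 (Complex.exp (2 * Real.pi * Complex.I * (r : ℂ))) (Complex.exp_ne_zero _)))
      (by
        intro r r'
        rw [← ofMul_mul]
        congr 1
        ext
        simp only [Units.val_mk0, Units.val_mul, Rat.cast_add, mul_add, Complex.exp_add])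
  have he : ∀ r : ℚ, e r = 0 ↔ ∃ n : ℤ, (n : ℚ) = r := by
    intro r
    constructor
    · intro h
      have h1 : Complex.exp (2 * Real.pi * Complex.I * (r : ℂ)) = 1 := by
        have := congrArg (fun x : Additive ℂˣ => ((Additive.toMul x : ℂˣ) : ℂ)) h
        simpa [e] using this
      obtain ⟨n, hn⟩ := Complex.exp_eq_one_iff.mp h1
      refine ⟨n, ?_⟩
      have h2 : (r : ℂ) = (n : ℂ) := by
        have hne : (2 * Real.pi * Complex.I : ℂ) ≠ 0 := by
          simp [Real.pi_ne_zero, Complex.I_ne_zero]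
        have : (2 * Real.pi * Complex.I : ℂ) * (r : ℂ) = (2 * Real.pi * Complex.I) * (n : ℂ) := by
          rw [hn]; ring
        exact mul_left_cancel₀ hne this
      have h3 : ((n : ℚ) : ℂ) = (r : ℂ) := by rw [h2]; push_cast; rfl
      exact_mod_cast h3
    · rintro ⟨n, rfl⟩
      apply Additive.toMul.injective
      ext
      simp only [e, AddMonoidHom.mk'_apply, toMul_ofMul, Units.val_mk0, toMul_zero,
        Units.val_one, Rat.cast_intCast]
      rw [Complex.exp_eq_one_iff]
      exact ⟨n, by ring⟩
  -- descend to `ℚ/ℤ`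
  let ι : AddCircle (1 : ℚ) →+ Additive ℂˣ :=
    QuotientAddGroup.lift (AddSubgroup.zmultiples (1 : ℚ)) e (by
      intro x hx
      obtain ⟨n, rfl⟩ := AddSubgroup.mem_zmultiples_iff.mp hx
      rw [AddMonoidHom.mem_ker, he]
      exact ⟨n, by simp⟩)
  have hι : ∀ t, ι t = 0 → t = 0 := by
    intro t ht
    induction t using QuotientAddGroup.induction_on with
    | H r =>
      rw [QuotientAddGroup.lift_mk, he] at ht
      obtain ⟨n, rfl⟩ := ht
      exact (QuotientAddGroup.eq_zero_iff _).mpr (AddSubgroup.mem_zmultiples_iff.mpr ⟨n, by simp⟩)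
  let φ : Q →* ℂˣ := MonoidHom.mk' (fun a => Additive.toMul (ι (c (Additive.ofMul a))))
    (fun a b => by rw [ofMul_mul, map_add, map_add, toMul_add])
  refine ⟨φ, fun h => hc (hι _ ?_)⟩
  have h' : Additive.toMul (ι (c (Additive.ofMul q))) = 1 := h
  rw [← ofMul_toMul (ι (c (Additive.ofMul q))), h', ofMul_one]

end Characters

/-! ### The finite part of an idèle of `ℚ` in `GL₁(𝔸_ℚ^∞)` -/

section FinitePart

/-- The `(0,0)` entry of the finite part `y_f ∈ GL₁(𝔸_ℚ^∞)` of an idèle `y` (the hom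
`GLn.sndHom ∘ scalar`) is the finite component of `y`. [folklore] -/
theorem coe_sndHom_scalar_apply (y : ideleGroup ℚ) :
    ((GLn.sndHom 1 ℚ (Matrix.GeneralLinearGroup.scalar (Fin 1) y) :
        GL (Fin 1) (FiniteAdeleRing (𝓞 ℚ) ℚ)) : Matrix (Fin 1) (Fin 1) (FiniteAdeleRing (𝓞 ℚ) ℚ)) 0 0 =
      (y : AdeleRing (𝓞 ℚ) ℚ).2 := by
  change (((Matrix.GeneralLinearGroup.scalar (Fin 1) y : GL (Fin 1) (AdeleRing (𝓞 ℚ) ℚ)) :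
    Matrix (Fin 1) (Fin 1) (AdeleRing (𝓞 ℚ) ℚ)) 0 0).2 = _
  rw [Matrix.GeneralLinearGroup.coe_scalar, Matrix.scalar_apply, Matrix.diagonal_apply_eq]

/-- Two elements of `GL₁` agree iff their `(0,0)` entries do. [folklore] -/
theorem GL_fin_one_ext {R : Type*} [CommRing R] {g h : GL (Fin 1) R}
    (e : (g : Matrix (Fin 1) (Fin 1) R) 0 0 = (h : Matrix (Fin 1) (Fin 1) R) 0 0) : g = h :=
  Matrix.GeneralLinearGroup.ext fun i j => by
    rw [Subsingleton.elim i 0, Subsingleton.elim j 0]; exact e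

/-- **`((1, g))_f = g`**: the finite part of the idèle `det (1, g)`, `g ∈ GL₁(𝔸_ℚ^∞)`, is `g`.
[folklore] -/
theorem sndHom_scalar_det_ofFinite (g : BigHeckeGLn.FiniteAdelicGL 1 ℚ) :
    GLn.sndHom 1 ℚ (Matrix.GeneralLinearGroup.scalar (Fin 1)
      (Matrix.GeneralLinearGroup.det (GLn.ofFinite 1 ℚ g))) = g := by
  refine GL_fin_one_ext ?_
  rw [coe_sndHom_scalar_apply, Matrix.GeneralLinearGroup.val_det_apply, Matrix.det_fin_one,
    GLn.coe_ofFinite_apply]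

/-- The idèle `det (1, g)` has archimedean component `1`. [folklore] -/
theorem fst_det_ofFinite (g : BigHeckeGLn.FiniteAdelicGL 1 ℚ) :
    ((Matrix.GeneralLinearGroup.det (GLn.ofFinite 1 ℚ g) : ideleGroup ℚ) : AdeleRing (𝓞 ℚ) ℚ).1 = 1 := by
  rw [Matrix.GeneralLinearGroup.val_det_apply, Matrix.det_fin_one, GLn.coe_ofFinite_apply,
    Matrix.one_apply_eq]

/-- The idèle `det (1, g)` has finite component the entry of `g`. [folklore] -/
theorem snd_det_ofFinite (g : BigHeckeGLn.FiniteAdelicGL 1 ℚ) :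
    ((Matrix.GeneralLinearGroup.det (GLn.ofFinite 1 ℚ g) : ideleGroup ℚ) : AdeleRing (𝓞 ℚ) ℚ).2 =
      (g : Matrix (Fin 1) (Fin 1) (FiniteAdeleRing (𝓞 ℚ) ℚ)) 0 0 := by
  rw [Matrix.GeneralLinearGroup.val_det_apply, Matrix.det_fin_one, GLn.coe_ofFinite_apply]

/-- **The finite part of a principal idèle** `(q)`, `q ∈ ℚ^×`, is the diagonally embedded
`q ∈ GL₁(ℚ) ↪ GL₁(𝔸_ℚ^∞)`. [folklore] -/
theorem sndHom_scalar_principalIdele (q : ℚˣ) :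
    GLn.sndHom 1 ℚ (Matrix.GeneralLinearGroup.scalar (Fin 1) (GaloisRepresentations.principalIdele ℚ q)) =
      BigHeckeGLn.globalEmbedding 1 ℚ (glDiagonal 1 ℚ fun _ => q) := by
  refine GL_fin_one_ext ?_
  rw [coe_sndHom_scalar_apply, BigHeckeGLn.globalEmbedding]
  change _ = algebraMap ℚ (FiniteAdeleRing (𝓞 ℚ) ℚ)
    ((glDiagonal 1 ℚ (fun _ => q) : Matrix (Fin 1) (Fin 1) ℚ) 0 0)
  rw [coe_glDiagonal, Matrix.diagonal_apply_eq]
  rfl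

/-- **The finite part of a local idèle** `⟨u⟩_v` is the `1 × 1` matrix of the finite idèle
`(u at v, 1 elsewhere)` (`uniformizerIdele`). [folklore] -/
theorem sndHom_scalar_localUnits (v : HeightOneSpectrum (𝓞 ℚ)) (u : (v.adicCompletion ℚ)ˣ) :
    GLn.sndHom 1 ℚ (Matrix.GeneralLinearGroup.scalar (Fin 1) (localUnits v u)) =
      glDiagonal 1 (FiniteAdeleRing (𝓞 ℚ) ℚ) fun _ => uniformizerIdele ℚ v u := by
  refine GL_fin_one_ext ?_
  rw [coe_sndHom_scalar_apply, coe_glDiagonal, Matrix.diagonal_apply_eq]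
  rfl

/-- `(1, diag(⟨u⟩_v)) = t_{v,1}(u)`: the `1 × 1` matrix of the finite idèle of `u ∈ ℚ_v^×`, put
back into `GL₁(𝔸_ℚ)`, is the Hecke element `heckeDiagAt 1 ℚ v u 1`. [folklore] -/
theorem ofFinite_glDiagonal_uniformizerIdele (v : HeightOneSpectrum (𝓞 ℚ))
    (u : (v.adicCompletion ℚ)ˣ) :
    GLn.ofFinite 1 ℚ (glDiagonal 1 (FiniteAdeleRing (𝓞 ℚ) ℚ) fun _ => uniformizerIdele ℚ v u) =
      heckeDiagAt 1 ℚ v u 1 := by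
  refine Matrix.GeneralLinearGroup.ext fun a b => ?_
  rw [Subsingleton.elim a 0, Subsingleton.elim b 0, GLn.coe_ofFinite_apply, Matrix.one_apply_eq,
    heckeDiagAt, coe_glDiagonal, coe_glDiagonal, Matrix.diagonal_apply_eq, Matrix.diagonal_apply_eq,
    if_pos (show ((0 : Fin 1) : ℕ) < 1 from Nat.zero_lt_one)]
  rfl

/-- In rank one the Hecke element `t_{v,1}` is the `1 × 1` matrix of the finite idèle of the
fixed uniformiser `ϖ_v`. [folklore] -/
theorem BigHeckeGLn.heckeElement_one_one (v : HeightOneSpectrum (𝓞 ℚ)) :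
    BigHeckeGLn.heckeElement 1 ℚ v 1 =
      glDiagonal 1 (FiniteAdeleRing (𝓞 ℚ) ℚ) fun _ => uniformizerIdele ℚ v (BigHeckeGLn.uniformizerAt v) := by
  rw [BigHeckeGLn.heckeElement]
  congr 1
  funext k
  rw [if_pos (show (k : ℕ) < 1 from by simp)]

/-- In rank one `t_{v,0} = 1`. [folklore] -/
theorem BigHeckeGLn.heckeElement_one_zero (v : HeightOneSpectrum (𝓞 ℚ)) :
    BigHeckeGLn.heckeElement 1 ℚ v 0 = 1 := by
  refine Matrix.GeneralLinearGroup.ext fun a b => ?_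
  rw [Subsingleton.elim a 0, Subsingleton.elim b 0, BigHeckeGLn.heckeElement, coe_glDiagonal,
    Matrix.diagonal_apply_eq, if_neg (Nat.not_lt_zero _), Units.val_one, Units.val_one,
    Matrix.one_apply_eq]

/-- **Local units lie in the level away from `N`**: for `v ∤ 𝔫 ≠ 0` and `u ∈ ℤ_v^×` (valuation
`1`), the matrix of the finite idèle `(u at v, 1 elsewhere)` lies in `K_f(𝔫)` (`K(𝔫)` is maximal
at `v`, `isMaximalAt_principalCongruenceLevel`). [folklore] -/
theorem glDiagonal_uniformizerIdele_mem_level_of_valued_eq_one {𝔫 : Ideal (𝓞 ℚ)} (h𝔫 : 𝔫 ≠ 0)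
    {v : HeightOneSpectrum (𝓞 ℚ)} (hv : ¬ v.asIdeal ∣ 𝔫) {u : (v.adicCompletion ℚ)ˣ}
    (hu : Valued.v (u : v.adicCompletion ℚ) = 1) :
    (glDiagonal 1 (FiniteAdeleRing (𝓞 ℚ) ℚ) fun _ => uniformizerIdele ℚ v u) ∈
      finitePrincipalCongruenceLevel 1 ℚ 𝔫 := by
  rw [mem_finitePrincipalCongruenceLevel_iff, ofFinite_glDiagonal_uniformizerIdele,
    heckeDiagAt_eq_ofLocal_glDiagonal]
  refine isMaximalAt_principalCongruenceLevel 1 ℚ v h𝔫 hv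
    ⟨_, glDiagonal_mem_valuedCongruenceSubgroup_one (fun k => ?_) (fun k => ?_), rfl⟩
  · split_ifs
    · exact hu.le
    · simp
  · split_ifs
    · rw [Units.val_inv_eq_inv_val, map_inv₀, hu, inv_one]
    · simp

/-- **Unit idèles congruent to `1` modulo `𝔫` have finite part in `K_f(𝔫)`**: if every finite
component of `y` is a unit and `|y_v - 1|_v ≤ |𝔫|_v` for all `v`, then `y_f ∈ K_f(𝔫)`.
[folklore] -/
theorem sndHom_scalar_mem_level_of_valued {𝔫 : Ideal (𝓞 ℚ)} {y : ideleGroup ℚ}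
    (h1 : ∀ v : HeightOneSpectrum (𝓞 ℚ), Valued.v (((y : AdeleRing (𝓞 ℚ) ℚ).2) v) = 1)
    (h2 : ∀ v : HeightOneSpectrum (𝓞 ℚ),
      Valued.v (((y : AdeleRing (𝓞 ℚ) ℚ).2) v - 1) ≤ idealRadius ℚ v 𝔫) :
    GLn.sndHom 1 ℚ (Matrix.GeneralLinearGroup.scalar (Fin 1) y) ∈
      finitePrincipalCongruenceLevel 1 ℚ 𝔫 := by
  set h : GL (Fin 1) (FiniteAdeleRing (𝓞 ℚ) ℚ) :=
    GLn.sndHom 1 ℚ (Matrix.GeneralLinearGroup.scalar (Fin 1) y) with hh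
  have hent : ∀ i j, (h : Matrix (Fin 1) (Fin 1) (FiniteAdeleRing (𝓞 ℚ) ℚ)) i j =
      (y : AdeleRing (𝓞 ℚ) ℚ).2 := fun i j => by
    rw [Subsingleton.elim i 0, Subsingleton.elim j 0, hh, coe_sndHom_scalar_apply]
  have hent' : ∀ i j, ((h⁻¹ : GL (Fin 1) (FiniteAdeleRing (𝓞 ℚ) ℚ)) :
      Matrix (Fin 1) (Fin 1) (FiniteAdeleRing (𝓞 ℚ) ℚ)) i j = ((y⁻¹ : ideleGroup ℚ) : AdeleRing (𝓞 ℚ) ℚ).2 :=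
    fun i j => by
    rw [Subsingleton.elim i 0, Subsingleton.elim j 0, hh, ← map_inv, ← map_inv, coe_sndHom_scalar_apply]
  have h1' : ∀ v, Valued.v ((((y⁻¹ : ideleGroup ℚ) : AdeleRing (𝓞 ℚ) ℚ).2) v) = 1 := fun v => by
    rw [ideleGroup_val_inv_snd, map_inv₀, h1 v, inv_one]
  rw [mem_finitePrincipalCongruenceLevel_iff, mem_principalCongruenceLevel_iff]
  refine ⟨GLn.ofFinite_mem_glIntegralLevel ?_, fun v => ?_⟩
  · rw [mem_glFiniteIntegralLevel_iff]
    refine ⟨fun i j v => ?_, fun i j v => ?_⟩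
    · rw [hent]
      exact (HeightOneSpectrum.mem_adicCompletionIntegers (R := 𝓞 ℚ) ℚ v).2 (h1 v).le
    · rw [hent']
      exact (HeightOneSpectrum.mem_adicCompletionIntegers (R := 𝓞 ℚ) ℚ v).2 (h1' v).le
  · change Matrix.GeneralLinearGroup.map (AdelicGroupData.adeleEval ℚ v) (GLn.ofFinite 1 ℚ h) ∈ _
    have hloc : ∀ i j, (Matrix.GeneralLinearGroup.map (AdelicGroupData.adeleEval ℚ v) (GLn.ofFinite 1 ℚ h) :
        Matrix (Fin 1) (Fin 1) (v.adicCompletion ℚ)) i j = ((y : AdeleRing (𝓞 ℚ) ℚ).2) v := fun i j => by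
      rw [Subsingleton.elim i 0, Subsingleton.elim j 0, AdelicGroupData.coe_map_adeleEval_apply,
        GLn.coe_ofFinite_apply, AdelicGroupData.adeleEval_apply, hent]
    have hloc' : ∀ i j, (((Matrix.GeneralLinearGroup.map (AdelicGroupData.adeleEval ℚ v) (GLn.ofFinite 1 ℚ h))⁻¹ :
        GL (Fin 1) (v.adicCompletion ℚ)) : Matrix (Fin 1) (Fin 1) (v.adicCompletion ℚ)) i j =
        (((y⁻¹ : ideleGroup ℚ) : AdeleRing (𝓞 ℚ) ℚ).2) v :=
      fun i j => by
      rw [Subsingleton.elim i 0, Subsingleton.elim j 0, ← map_inv, ← map_inv,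
        AdelicGroupData.coe_map_adeleEval_apply, GLn.coe_ofFinite_apply, AdelicGroupData.adeleEval_apply, hent']
    refine ⟨fun i j => ?_, fun i j => ?_, fun i j => ?_⟩
    · rw [hloc]; exact (h1 v).le
    · rw [hloc']; exact (h1' v).le
    · rw [Matrix.sub_apply, hloc, Subsingleton.elim j i, Matrix.one_apply_eq]
      exact h2 v

end FinitePart

/-! ### `GL₁(𝔸_ℚ^∞) = GL₁(ℚ)⁺ · ⟨t_{v,1} : v ∤ N⟩ · K_f(N)` -/

section Generation

/-- A `v`-adic unit decomposes as `u = ϖ_v^{-a} · (u ϖ_v^{a})` with `u ϖ_v^a ∈ ℤ_v^×`, `ϖ_v` the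
fixed uniformiser (`|u| = exp a`). [folklore] -/
theorem exists_zpow_uniformizerAt_mul_eq (v : HeightOneSpectrum (𝓞 ℚ)) (u : (v.adicCompletion ℚ)ˣ) :
    ∃ (a : ℤ) (u₀ : (v.adicCompletion ℚ)ˣ), Valued.v (u₀ : v.adicCompletion ℚ) = 1 ∧
      u = BigHeckeGLn.uniformizerAt v ^ (-a) * u₀ := by
  have hz0 : Valued.v (u : v.adicCompletion ℚ) ≠ 0 := (map_ne_zero _).2 u.ne_zero
  set a : ℤ := WithZero.log (Valued.v (u : v.adicCompletion ℚ)) with ha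
  have hua : Valued.v (u : v.adicCompletion ℚ) = WithZero.exp a := (WithZero.exp_log hz0).symm
  refine ⟨a, u * BigHeckeGLn.uniformizerAt v ^ a, ?_, ?_⟩
  · rw [Units.val_mul, Units.val_zpow_eq_zpow_val, map_mul, map_zpow₀, hua,
      BigHeckeGLn.valued_uniformizerAt, ← WithZero.exp_zsmul, smul_eq_mul, mul_neg, mul_one,
      ← WithZero.exp_add, add_neg_cancel, WithZero.exp_zero]
  · rw [mul_left_comm, ← zpow_add, neg_add_cancel, zpow_zero, mul_one]

/-- **Generators of `GL₁(𝔸_ℚ^∞)` modulo a level.**  For `N ≥ 1`, a subgroup `S` of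
`GL₁(𝔸_ℚ^∞)` which contains the principal congruence subgroup `K_f(N)`, the diagonally embedded
`GL₁(ℚ)⁺ = ℚ^×_{>0}` and the Hecke elements `t_{v,1} = (ϖ_v at v, 1 elsewhere)` for all `v ∤ N` is
all of `GL₁(𝔸_ℚ^∞)`: `𝔸_{ℚ,f}^× = ℚ_{>0}^× · ⟨ϖ_p : p ∤ N⟩ · K_f(N)` (`𝕀_ℚ = ℚ^× (ℝ_{>0} × ẑ^×)`
and `ẑ^× / K_f(N) = (ℤ/N)^×` is represented by positive integers prime to `N`;
[Neukirch, Ch. VI §1, Prop. (1.9)–(1.10)], Gelbart (1975), (3.3)).  Proof by duality: the preimage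
`S'` of `S` under `y ↦ (y r(y)⁻¹)_f` (`Rat.unitIdele`, `Rat.ratPart`) is an open subgroup of
`𝕀_ℚ` containing `ℚ^×` and all `ℚ_v^×`, `v ∤ N`; a `ℂˣ`-valued character of `𝕀_ℚ / S'` is a Hecke
character trivial on these, hence trivial (`HeckeCharacter.eq_one_of_forall_localUnits`), so
`S' = 𝕀_ℚ` (`exists_monoidHom_unitsComplex_apply_ne_one`), and `g = ((1,g) r⁻¹)_f · (r)_f` with
`r = r((1,g)) > 0`. [cite: NeukirchANT1999, Ch. VI Prop. (1.10)] -/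
theorem BigHeckeGLn.eq_top_of_level_le_of_globalEmbedding_mem_of_heckeElement_mem_rat
    {N : ℕ} (hN : 1 ≤ N) {S : Subgroup (BigHeckeGLn.FiniteAdelicGL 1 ℚ)}
    (hL : finitePrincipalCongruenceLevel 1 ℚ (Ideal.span {(N : 𝓞 ℚ)}) ≤ S)
    (hΓ : ∀ γ : Matrix.GLPos (Fin 1) ℚ, BigHeckeGLn.globalEmbedding 1 ℚ (γ : GL (Fin 1) ℚ) ∈ S)
    (hT : ∀ v : HeightOneSpectrum (𝓞 ℚ), ¬ v.asIdeal ∣ Ideal.span {(N : 𝓞 ℚ)} →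
      BigHeckeGLn.heckeElement 1 ℚ v 1 ∈ S) :
    S = ⊤ := by
  set 𝔫 : Ideal (𝓞 ℚ) := Ideal.span {(N : 𝓞 ℚ)} with h𝔫def
  have hN0 : 𝔫 ≠ 0 := by
    rw [h𝔫def, Ne, Ideal.zero_eq_bot, Ideal.span_singleton_eq_bot]
    exact_mod_cast (Nat.one_le_iff_ne_zero.mp hN)
  -- the finite-part homomorphism and the pulled-back subgroup of the idèles
  set fGL : ideleGroup ℚ →* BigHeckeGLn.FiniteAdelicGL 1 ℚ :=
    (GLn.sndHom 1 ℚ).comp (Matrix.GeneralLinearGroup.scalar (Fin 1)) with hfGL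
  have hfGL_apply : ∀ y, fGL y = GLn.sndHom 1 ℚ (Matrix.GeneralLinearGroup.scalar (Fin 1) y) :=
    fun y => rfl
  set S' : Subgroup (ideleGroup ℚ) := S.comap (fGL.comp Rat.unitIdele) with hS'
  have hmemS' : ∀ y, y ∈ S' ↔ fGL (Rat.unitIdele y) ∈ S := fun y => Iff.rfl
  -- positive rationals
  have hpos : ∀ q : ℚˣ, (0 : ℚ) < q → fGL (GaloisRepresentations.principalIdele ℚ q) ∈ S := by
    intro q hq
    have hdet : 0 < Matrix.det ((glDiagonal 1 ℚ fun _ => q : GL (Fin 1) ℚ) : Matrix (Fin 1) (Fin 1) ℚ) := by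
      rw [coe_glDiagonal, Matrix.det_diagonal, Fin.prod_univ_one]; exact hq
    have h := hΓ ⟨glDiagonal 1 ℚ fun _ => q, (Matrix.mem_glpos _).2 (by
      rwa [Matrix.GeneralLinearGroup.val_det_apply])⟩
    rwa [hfGL_apply, sndHom_scalar_principalIdele]
  -- local idèles at `v ∤ N`
  have hloc : ∀ v : HeightOneSpectrum (𝓞 ℚ), ¬ v.asIdeal ∣ 𝔫 → ∀ u : (v.adicCompletion ℚ)ˣ,
      fGL (localUnits v u) ∈ S := by
    intro v hv u
    obtain ⟨a, u₀, hu₀, rfl⟩ := exists_zpow_uniformizerAt_mul_eq v u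
    rw [hfGL_apply, sndHom_scalar_localUnits]
    have hfun : (fun _ : Fin 1 => uniformizerIdele ℚ v (BigHeckeGLn.uniformizerAt v ^ (-a) * u₀)) =
        (fun _ : Fin 1 => uniformizerIdele ℚ v (BigHeckeGLn.uniformizerAt v)) ^ (-a) *
          fun _ : Fin 1 => uniformizerIdele ℚ v u₀ := by
      funext k
      rw [Pi.mul_apply, Pi.pow_apply, map_mul, map_zpow]
    rw [hfun, map_mul, map_zpow, ← BigHeckeGLn.heckeElement_one_one]
    exact S.mul_mem (S.zpow_mem (hT v hv) _)
      (hL (glDiagonal_uniformizerIdele_mem_level_of_valued_eq_one hN0 hv hu₀))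
  -- Step 1: `S'` is all of `𝕀_ℚ`
  have key : ∀ y : ideleGroup ℚ, y ∈ S' := by
    intro y
    by_contra hy
    -- a character of `𝕀_ℚ / S'` non-trivial at `y`
    have hq : (QuotientGroup.mk y : ideleGroup ℚ ⧸ S') ≠ 1 := by
      rwa [Ne, QuotientGroup.eq_one_iff]
    obtain ⟨φ, hφ⟩ := exists_monoidHom_unitsComplex_apply_ne_one hq
    set ψ₀ : ideleGroup ℚ →* ℂˣ := φ.comp (QuotientGroup.mk' S') with hψ₀
    have hψ₀S : ∀ z ∈ S', ψ₀ z = 1 := fun z hz => by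
      rw [hψ₀, MonoidHom.comp_apply, QuotientGroup.mk'_apply, (QuotientGroup.eq_one_iff z).2 hz, map_one]
    -- `S'` is a neighbourhood of `1`, so `ψ₀` is continuous
    set T : Finset (HeightOneSpectrum (𝓞 ℚ)) := (Ideal.finite_factors hN0).toFinset with hTdef
    have hT_iff : ∀ v, v ∈ T ↔ v.asIdeal ∣ 𝔫 := fun v => by
      rw [hTdef, Set.Finite.mem_toFinset]; rfl
    set e : HeightOneSpectrum (𝓞 ℚ) → ℕ := fun v =>
      (Associates.mk v.asIdeal).count (Associates.mk 𝔫).factors with hedef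
    have hrad : ∀ v, idealRadius ℚ v 𝔫 = WithZero.exp (-(e v : ℤ)) := fun v => by
      rw [idealRadius, FractionalIdeal.count_coe ℚ v hN0]
    have hnhds : ∀ᶠ z : ideleGroup ℚ in 𝓝 1, z ∈ S' := by
      have h3 : ∀ᶠ z : ideleGroup ℚ in 𝓝 1, ∀ v ∈ T,
          Valued.v ((z : AdeleRing (𝓞 ℚ) ℚ).2 v - 1) ≤ WithZero.exp (-(e v : ℤ)) :=
        (T.eventually_all).2 fun v _ => Rat.eventually_valued_sub_one_le v (e v)
      filter_upwards [Rat.eventually_infReal_pos, eventually_valued_snd_eq_one, h3] with z hz1 hz2 hz3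
      rw [hmemS', Rat.unitIdele_eq_self z hz1 hz2]
      refine hL (sndHom_scalar_mem_level_of_valued hz2 fun v => ?_)
      by_cases hv : v ∈ T
      · rw [hrad]; exact hz3 v hv
      · rw [idealRadius_eq_one_of_not_dvd hN0 ((hT_iff v).not.mp hv)]
        exact (Valuation.map_sub _ _ _).trans (max_le (hz2 v).le (Valuation.map_one _).le)
    have hcont : Continuous ψ₀ := by
      refine continuous_of_continuousAt_one ψ₀ ?_
      have h : (fun _ : ideleGroup ℚ => (1 : ℂˣ)) =ᶠ[𝓝 1] ψ₀ := by
        filter_upwards [hnhds] with z hz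
        exact (hψ₀S z hz).symm
      have := (tendsto_const_nhds (x := (1 : ℂˣ)) (f := 𝓝 (1 : ideleGroup ℚ))).congr' h
      rwa [ContinuousAt, map_one]
    -- the Hecke character
    let ψ : HeckeCharacter ℚ :=
      { toContinuousMonoidHom := { toMonoidHom := ψ₀, continuous_toFun := hcont }
        map_principal' := fun x hx => by
          obtain ⟨q, rfl⟩ := hx
          change ψ₀ (GaloisRepresentations.principalIdele ℚ q) = 1
          refine hψ₀S _ ?_
          rw [hmemS', Rat.unitIdele_principalIdele, map_one]
          exact S.one_mem }
    have hψ : ∀ z, ψ z = ψ₀ z := fun z => rfl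
    -- trivial on `ℚ_vˣ` for `v ∤ N`
    have hψloc : ∀ v ∉ T, ∀ u : (v.adicCompletion ℚ)ˣ, ψ (localUnits v u) = 1 := by
      intro v hv u
      rw [hψ]
      refine hψ₀S _ ?_
      have hv' : ¬ v.asIdeal ∣ 𝔫 := (hT_iff v).not.mp hv
      rw [hmemS', Rat.unitIdele_apply, map_mul, map_inv]
      refine S.mul_mem (hloc v hv' u) (S.inv_mem (hpos _ ?_))
      rw [Rat.ratPart_pos_iff, Rat.infReal_localUnits]
      exact one_pos
    have hψ1 : ψ = 1 := HeckeCharacter.eq_one_of_forall_localUnits hψloc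
    have : ψ₀ y = 1 := by rw [← hψ, hψ1, HeckeCharacter.one_apply]
    exact hφ (by rwa [hψ₀, MonoidHom.comp_apply, QuotientGroup.mk'_apply] at this)
  -- Step 2: every `g` is `((1,g) r⁻¹)_f · r_f`
  rw [eq_top_iff]
  intro g _
  set y : ideleGroup ℚ := Matrix.GeneralLinearGroup.det (GLn.ofFinite 1 ℚ g) with hydef
  have hy : fGL (Rat.unitIdele y) ∈ S := (hmemS' y).1 (key y)
  rw [Rat.unitIdele_apply, map_mul, map_inv] at hy
  have hyf : fGL y = g := by rw [hfGL_apply, hydef, sndHom_scalar_det_ofFinite]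
  have hr : (0 : ℚ) < Rat.ratPart y := by
    rw [Rat.ratPart_pos_iff, Rat.infReal_apply, hydef, fst_det_ofFinite]
    change 0 < Rat.completionRealEquiv Rat.infinitePlace 1
    rw [map_one]; exact one_pos
  have h := S.mul_mem hy (hpos _ hr)
  rwa [inv_mul_cancel_right, hyf] at h

end Generation

end Literature.NumberTheory.Automorphic
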